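import Literature.Probability.Process.MartingaleClockTimeChange
import HarnessLib

/-!
# Time change of a martingale clock: progressive version with almost surely continuous paths

Topic `Probability/Process`; theorems only. `HasMartingaleClock.timeChange`
(`MartingaleClockTimeChange.lean`; Revuz–Yor (1999) Ch. V Thm. (1.6), bounded case) asks for a
strongly adapted process with continuous paths for EVERY `ω`; both enter its proof only through
progressive measurability and the almost-sure continuity used by the optional sampling theorem.
This file records the version with exactly those hypotheses — a strongly PROGRESSIVE process whose
paths are continuous ALMOST SURELY — needed when the martingale is a modification defined by a
limit (the through-swallow image driving value of the locality of SLE₆, crux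
`stmt-CriticalPhenomena-0698`), together with the pathwise continuity of the time-changed process
at every `ω` whose path is continuous.
-/

noncomputable section

open MeasureTheory Filter Set Function
open scoped NNReal ENNReal Topology

namespace Literature.Probability.Process

variable {Ω : Type*} {m : MeasurableSpace Ω} {𝓕 : Filtration ℝ≥0 m} {P : Measure Ω}
  {Y c : ℝ≥0 → Ω → ℝ} {ρ : Ω → ℝ≥0} {N : ℝ} {T : ℝ≥0}

/-- **Time change of a martingale clock, progressive version** (Dambis–Dubins–Schwarz, bounded
case): as `HasMartingaleClock.timeChange`, for a strongly progressive `Y` with almost surely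
continuous paths. [cite: RevuzYor1999, Ch. V Thm (1.6)] -/
theorem HasMartingaleClock.timeChange_of_isStronglyProgressive [IsProbabilityMeasure P]
    (h : HasMartingaleClock Y c 𝓕 P N) (hYprog : IsStronglyProgressive 𝓕 Y)
    (hYc : ∀ᵐ ω ∂P, Continuous (Y · ω))
    (hcad : Adapted 𝓕 c) (hρ : IsStoppingTime 𝓕 fun ω ↦ (ρ ω : WithTop ℝ≥0)) (hρT : ∀ ω, ρ ω ≤ T)
    (hfrozen : ∀ t ω, c t ω = c (min t (ρ ω)) ω) :
    HasMartingaleClock (tcProc Y c ρ) (fun s ω ↦ min (s : ℝ) (totalClock c ρ ω))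
      (tcFiltration hcad h.continuous_clock hρ) P N := by
  have hcc := h.continuous_clock
  have hc0 := h.clock_zero
  have hmono := h.monotone_clock
  set 𝒢 := tcFiltration hcad hcc hρ with h𝒢
  have hYad : StronglyAdapted 𝓕 Y := hYprog.stronglyAdapted
  have hinv : ∀ s, IsStoppingTime 𝓕 (invClock c ρ s) := isStoppingTime_invClock hcad hcc hρ
  have hfin : ∀ s, ∀ᵐ ω ∂P, invClock c ρ s ω ≠ ⊤ := fun s ↦ ae_of_all _ fun ω ↦ invClock_ne_top s ω
  -- the two bounded continuous martingales
  have hM1 : Martingale Y 𝓕 P := h.martingale hYad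
  have hM2 : Martingale (fun t ω ↦ Y t ω ^ 2 - c t ω) 𝓕 P := h.martingale_sq_sub hYad hcad
  have hM1c : ∀ᵐ ω ∂P, Continuous (Y · ω) := hYc
  have hM2c : ∀ᵐ ω ∂P, Continuous fun t ↦ Y t ω ^ 2 - c t ω := by
    filter_upwards [hYc] with ω hω
    exact (hω.pow 2).sub (hcc ω)
  -- bounds of the stopped processes at the inverse clocks
  have hcT : ∀ (s : ℝ≥0) (n : ℕ) ω, |c ((min (n : WithTop ℝ≥0) (invClock c ρ s ω)).untopA) ω| ≤ T := by
    intro s n ω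
    rw [abs_of_nonneg (h.clock_nonneg ω _)]
    refine (h.clock_le ω _).trans ?_
    have h1 : (min (n : WithTop ℝ≥0) (invClock c ρ s ω)).untopA ≤ invClockFun c ρ s ω := by
      rw [invClock_eq_coe]
      have : (min ((n : ℝ≥0) : WithTop ℝ≥0) (invClockFun c ρ s ω : WithTop ℝ≥0)).untopA =
          min (n : ℝ≥0) (invClockFun c ρ s ω) := untopA_min_coe_coe _ _
      rw [show ((n : ℕ) : WithTop ℝ≥0) = ((n : ℝ≥0) : WithTop ℝ≥0) from rfl, this]
      exact min_le_right _ _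
    exact_mod_cast h1.trans ((invClockFun_le s ω).trans (hρT ω))
  have hB1 : ∀ s s' : ℝ≥0, ∀ᵐ ω ∂P, ∀ n : ℕ, |stoppedProcess Y (invClock c ρ s') n ω| ≤ N ∧
      |stoppedProcess Y (invClock c ρ s) n ω| ≤ N := by
    intro s s'
    filter_upwards [h.abs_le] with ω hω n
    exact ⟨hω _, hω _⟩
  have hB2 : ∀ s s' : ℝ≥0, ∀ᵐ ω ∂P, ∀ n : ℕ,
      |stoppedProcess (fun t ω ↦ Y t ω ^ 2 - c t ω) (invClock c ρ s') n ω| ≤ N ^ 2 + T ∧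
      |stoppedProcess (fun t ω ↦ Y t ω ^ 2 - c t ω) (invClock c ρ s) n ω| ≤ N ^ 2 + T := by
    intro s s'
    filter_upwards [h.abs_le] with ω hω n
    have key : ∀ s : ℝ≥0, |stoppedProcess (fun t ω ↦ Y t ω ^ 2 - c t ω) (invClock c ρ s) n ω| ≤ N ^ 2 + T := by
      intro s
      simp only [stoppedProcess]
      have h1 := hω ((min (n : WithTop ℝ≥0) (invClock c ρ s ω)).untopA)
      have h2 := hcT s n ω
      have h3 : |Y ((min (n : WithTop ℝ≥0) (invClock c ρ s ω)).untopA) ω ^ 2| ≤ N ^ 2 := by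
        rw [abs_pow]; exact pow_le_pow_left₀ (abs_nonneg _) h1 2
      exact (abs_sub _ _).trans (add_le_add h3 h2)
    exact ⟨key s', key s⟩
  -- measurability and integrability of the time-changed processes
  have hYm : ∀ s, Measurable[𝒢 s] (tcProc Y c ρ s) := measurable_tcProc hcad hcc hρ hYprog
  have hCm : ∀ s, Measurable[𝒢 s] fun ω ↦ min (s : ℝ) (totalClock c ρ ω) :=
    measurable_min_totalClock hcad hcc hρ hc0 hmono hfrozen
  have hYbdd : ∀ s, ∀ᵐ ω ∂P, |tcProc Y c ρ s ω| ≤ N := fun s ↦ by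
    filter_upwards [h.abs_le] with ω hω
    exact hω _
  have hσ0 : ∀ ω, 0 ≤ totalClock c ρ ω := fun ω ↦ h.clock_nonneg ω _
  have hσT : ∀ ω, totalClock c ρ ω ≤ T := fun ω ↦ (h.clock_le ω _).trans (by exact_mod_cast hρT ω)
  have hYint : ∀ s, Integrable (tcProc Y c ρ s) P := fun s ↦
    Integrable.mono' (integrable_const N) ((hYm s).mono (𝒢.le s) le_rfl).aestronglyMeasurable
      ((hYbdd s).mono fun ω hω ↦ by rw [Real.norm_eq_abs]; exact hω)
  set S2 : ℝ≥0 → Ω → ℝ := fun s ω ↦ tcProc Y c ρ s ω ^ 2 - min (s : ℝ) (totalClock c ρ ω) with hS2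
  have hS2m : ∀ s, Measurable[𝒢 s] (S2 s) := fun s ↦ ((hYm s).pow_const 2).sub (hCm s)
  have hS2int : ∀ s, Integrable (S2 s) P := fun s ↦ by
    refine Integrable.mono' (integrable_const (N ^ 2 + T)) ((hS2m s).mono (𝒢.le s) le_rfl).aestronglyMeasurable ?_
    filter_upwards [hYbdd s] with ω hω
    rw [Real.norm_eq_abs]
    have h3 : |tcProc Y c ρ s ω ^ 2| ≤ N ^ 2 := by rw [abs_pow]; exact pow_le_pow_left₀ (abs_nonneg _) hω 2
    have h4 : |min (s : ℝ) (totalClock c ρ ω)| ≤ T := by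
      rw [abs_of_nonneg (le_min s.coe_nonneg (hσ0 ω))]
      exact (min_le_right _ _).trans (hσT ω)
    exact (abs_sub _ _).trans (add_le_add h3 h4)
  -- the stopped value of `Y² - c` at `υ_s` is `S2 s`
  have hS2eq : ∀ s ω, S2 s ω = stoppedValue (fun t ω ↦ Y t ω ^ 2 - c t ω) (invClock c ρ s) ω := by
    intro s ω
    simp only [hS2, tcProc, stoppedValue]
    rw [← clock_invClockFun hc0 hcc hmono hfrozen s ω, invClockFun]
  -- optional sampling
  have hos1 : ∀ s s' : ℝ≥0, s ≤ s' → ∀ A, MeasurableSet[𝒢 s] A →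
      ∫ ω in A, tcProc Y c ρ s' ω ∂P = ∫ ω in A, tcProc Y c ρ s ω ∂P := by
    intro s s' hss' A hA
    exact setIntegral_stoppedValue_eq_of_le hM1 hM1c (hinv s) (hinv s') (invClock_mono' hcc hss') (hfin s')
      (hB1 s s') hA
  have hos2 : ∀ s s' : ℝ≥0, s ≤ s' → ∀ A, MeasurableSet[𝒢 s] A →
      ∫ ω in A, S2 s' ω ∂P = ∫ ω in A, S2 s ω ∂P := by
    intro s s' hss' A hA
    have h1 := setIntegral_stoppedValue_eq_of_le hM2 hM2c (hinv s) (hinv s') (invClock_mono' hcc hss') (hfin s')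
      (hB2 s s') hA
    rw [setIntegral_congr_fun ((𝒢.le s) _ hA) (fun ω _ ↦ hS2eq s' ω),
      setIntegral_congr_fun ((𝒢.le s) _ hA) (fun ω _ ↦ hS2eq s ω)]
    exact h1
  -- the martingale properties
  have hmart1 : IsAEMartingale (tcProc Y c ρ) 𝒢 P := by
    refine ⟨fun s ↦ (hYm s).stronglyMeasurable.aestronglyMeasurable, fun s s' hss' ↦ ?_⟩
    symm
    exact ae_eq_condExp_of_forall_setIntegral_eq (𝒢.le s) (hYint s')
      (fun A _ _ ↦ (hYint s).integrableOn) (fun A hA _ ↦ (hos1 s s' hss' A hA).symm)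
      (hYm s).stronglyMeasurable.aestronglyMeasurable
  have hmart2 : IsAEMartingale S2 𝒢 P := by
    refine ⟨fun s ↦ (hS2m s).stronglyMeasurable.aestronglyMeasurable, fun s s' hss' ↦ ?_⟩
    symm
    exact ae_eq_condExp_of_forall_setIntegral_eq (𝒢.le s) (hS2int s')
      (fun A _ _ ↦ (hS2int s).integrableOn) (fun A hA _ ↦ (hos2 s s' hss' A hA).symm)
      (hS2m s).stronglyMeasurable.aestronglyMeasurable
  exact
    { isAEMartingale := hmart1
      isAEMartingale_sq_sub := hmart2
      clock_zero := fun ω ↦ by simp only [NNReal.coe_zero, min_eq_left (hσ0 ω)]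
      clock_mono := fun ω s s' hss' ↦ min_le_min_right _ (NNReal.coe_le_coe.2 hss')
      clock_sub_le := fun ω s s' hss' ↦ min_sub_min_le_sub (NNReal.coe_le_coe.2 hss')
      abs_le := by
        filter_upwards [h.abs_le] with ω hω s
        exact hω _ }

/-- **The time-changed process has a continuous path at every `ω` whose path is continuous**
(strictly increasing clock before `ρ`). [folklore] -/
theorem continuous_tcProc_of_continuous {ω : Ω} (hYc : Continuous (Y · ω)) (hc0 : ∀ ω, c 0 ω = 0)
    (hcc : ∀ ω, Continuous fun t ↦ c t ω) (hmono : ∀ ω, Monotone fun t ↦ c t ω)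
    (hstrict : ∀ ω, StrictMonoOn (fun t ↦ c t ω) (Icc 0 (ρ ω))) :
    Continuous fun s ↦ tcProc Y c ρ s ω :=
  hYc.comp (continuous_invClockFun hc0 hcc hmono hstrict ω)

end Literature.Probability.Process

end
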